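import Literature.Analysis.FluidPDE.Antidivergence
import Literature.Analysis.FunctionSpaces.ContDiffHolderAlgebra
import HarnessLib

/-!
# The BDSV stationary phase estimates for `ℛ` (App. C, Prop. C.2) as named facts

Buckmaster–De Lellis–Székelyhidi–Vicol (BDSV), *Onsager's conjecture for admissible weak
solutions*, CPAM 72 (2019) = arXiv:1701.08678, App. C, Prop. C.2 ("a simple consequence of
classical stationary phase techniques. For a detailed proof the reader might consult
[DaSz2016, Lemma 2.2]" = Daneri–Székelyhidi 2017, Lemma 2.2):

> Let `α ∈ (0,1)` and `N ≥ 1`. Let `a ∈ C^∞(T³)`, `Φ ∈ C^∞(T³; ℝ³)` be smooth functions and assume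
> that `Ĉ⁻¹ ≤ |∇Φ| ≤ Ĉ` holds on `T³`. Then
> (C.1) `|∫_{T³} a(x) e^{ik·Φ} dx| ≲ (‖a‖_N + ‖a‖₀ ‖Φ‖_N) / |k|^N`,
> and for the operator `ℛ` defined in (4.1),
> `‖ℛ(a e^{ik·Φ})‖_α ≲ ‖a‖₀ / |k|^{1-α} + (‖a‖_{N+α} + ‖a‖₀ ‖Φ‖_{N+α}) / |k|^{N-α}`,
> where the implicit constant depends on `Ĉ`, `α` and `N`, but not on `k`.

These are the two analytic inputs of §6 that lie outside the paper: the second estimate drives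
the Nash, transport and oscillation error bounds of §6.1 (Prop. 6.1, `BDSV.stressEstimate`;
cf. `OnsagerBDSVStressSplit.lean`), applied to each mode `a e^{iλ_{q+1} k·Φ_i}` of the perturbation,
and (C.1) drives the energy estimate of §6.2 (Prop. 6.2, `BDSV.energyEstimate`). This file
transcribes them as **named facts** (`def … : Prop`, D-0014) for the honest objects of the tree:

* the phase. In the application `Φ = Φ_i` is a backward flow of `v̄_q`, i.e. `Φ = id + D` with a
  *periodic displacement* `D` (`BDSV.FlowDisplacement`), and `k ∈ λ_{q+1}ℤ³`, `λ_{q+1} ∈ 2πℕ`, so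
  that `e^{ik·Φ}` is periodic; the printed "`Φ ∈ C^∞(T³; ℝ³)`" is shorthand for this (the cited
  Lemma 2.2 of Daneri–Székelyhidi has the affine-periodic scalar phase
  `φ(x + 2πk) = φ(x) + 2πk·k₀`). On the unit torus `T³ = (ℝ/ℤ)³` of the tree the phase factor is
  `e^{2πi m·Φ(x)} = e_m(x) e^{2πi m·D(x)}`, `m ∈ ℤ³ ∖ {0}` (`BDSV.phaseExp m D`, with Mathlib's
  characters `UnitAddTorus.mFourier m = e_m`), and its real form
  `cos(2π m·Φ(x) + θ) = Re(e^{iθ} e^{2πi m·Φ(x)})` (`BDSV.phaseCos m D θ`), through which complex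
  amplitudes are handled by real and imaginary parts (`ℛ` is real-linear);
* the non-degeneracy "`Ĉ⁻¹ ≤ |∇Φ| ≤ Ĉ`" of the deformation `∇Φ = Id + ∇D` is read as the two-sided
  bound `Ĉ⁻¹|v| ≤ |(Id + ∇D(x))v| ≤ Ĉ|v|` for all `x, v` (`BDSV.IsNondegenerateDisplacement Ĉ D`),
  which is what the proof uses (`|∇(k·Φ)| = |∇Φᵀk| ≥ Ĉ⁻¹|k|`) and what Lemma 5.4 provides
  (`‖∇Φ_i - Id‖₀ ≤ 1/2`, arXiv (5.10));
* the norms are the accepted `Torus.eContDiffHolderNorm N α` (`∑_{j≤N} ‖Dʲ·‖_∞ + [D^N·]_α` of the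
  periodic lift, App. A; for `α = 0` the integer norms `‖·‖_N` up to a factor `3`); the norms
  "`‖Φ‖_N`, `‖Φ‖_{N+α}`" of the (non-periodic) phase are rendered by the norms of the displacement
  with ONE MORE derivative, `‖D‖_{C^{N+1}}`, `‖D‖_{C^{N+1,α}}`: the printed proof (Daneri–Székelyhidi
  2017, Lemma 2.2: `N` integrations by parts along `∇φ/|∇φ|²`, then Schauder) produces the
  seminorms `[∇φ]_N`, `[∇φ]_{N+α}` of the phase GRADIENT, which is how Lemma 2.2 is printed
  (`([a]_N + ‖a‖₀[∇φ]_N)/λ^N`, …); with `∇(m·Φ) = (Id + ∇D)ᵀ m` these are dominated by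
  `|m| ‖D‖_{C^{N+1(,α)}}`. So transcribed, both facts are implied by Lemma 2.2 of
  Daneri–Székelyhidi as printed and imply the uses of Prop. C.2 in §6 (where `‖Φ_i‖_{N+α}` is in any
  case estimated through `‖∇Φ_i‖_N ≲ ℓ^{-N}`, Prop. 5.7);
* powers of `|k|`: `BDSV.freqPow m s = |m|^s ∈ ℝ≥0∞` with the Euclidean length
  `|m| = (∑ m_j²)^{1/2} ≥ 1` (`Torus.freqNormSq`); constants are `ℝ≥0`, quantified after
  `Ĉ, α, N` and before everything else, as printed.

Contents: the definitions `BDSV.phaseArg`, `BDSV.phaseExp`, `BDSV.phaseCos`,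
`BDSV.IsNondegenerateDisplacement`, `BDSV.freqPow` with their elementary API (`|e^{2πi m·Φ}| = 1`,
`|cos| ≤ 1`, smoothness, `D = 0`, `|m|^{-s} ≤ 1`), and the named facts
`BDSV.phaseIntegralBound` ((C.1)) and `BDSV.antidivergencePhaseBound` (the `ℛ` estimate).
The Calderón–Zygmund input of their proofs, Prop. C.1, is the named fact `BDSV.holderCZBound` of
`OnsagerBDSVPotentialTheory.lean`.

## References

* T. Buckmaster, C. De Lellis, L. Székelyhidi Jr., V. Vicol, *Onsager's conjecture for admissible
  weak solutions*, Comm. Pure Appl. Math. 72 (2019) 229–274 = arXiv:1701.08678, App. C,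
  Prop. C.2 with (C.1); §6.1–6.2 (uses). [`BuckmasterEtAl2018`]
* S. Daneri, L. Székelyhidi Jr., *Non-uniqueness and h-principle for Hölder-continuous weak
  solutions of the Euler equations*, Arch. Ration. Mech. Anal. 224 (2017) 471–514 =
  arXiv:1603.09714, Lemma 2.2 (stationary phase lemma, with proof). [`DaneriSzekelyhidi2017`]
* C. De Lellis, L. Székelyhidi Jr., *Dissipative continuous Euler flows*, Invent. Math. 193
  (2013), Prop. 5.2 (the linear-phase case). [`DeLellisSzekelyhidiInvent2013`]
-/

noncomputable section

open MeasureTheory Set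
open scoped NNReal ENNReal ContDiff

namespace Literature.Analysis.FluidPDE

namespace BDSV

open FunctionSpaces FunctionSpaces.Torus

/-- The flat three-torus `T³ = (ℝ/ℤ)³`, local notation. -/
local notation "𝕋³" => UnitAddTorus (Fin 3)

/-- Euclidean `ℝ³`, local notation. -/
local notation "ℝ³" => EuclideanSpace ℝ (Fin 3)

/-! ## The phase `2π m·Φ`, `Φ = id + D` -/

section Phase

/-- The periodic part `2π m·D(x)` of the phase `2π m·Φ(x)`, `Φ = id + D`, for a frequency vector
`m ∈ ℤ³` and a periodic displacement `D : T³ → ℝ³`. [cite: BuckmasterEtAl2018, App. C Prop. C.2] -/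
def phaseArg (m : Fin 3 → ℤ) (D : 𝕋³ → ℝ³) (x : 𝕋³) : ℝ :=
  2 * Real.pi * ∑ j, (m j : ℝ) * D x j

/-- **The phase factor `e^{ik·Φ}` of Prop. C.2** on the unit torus: `e^{2πi m·Φ(x)} = e_m(x) e^{2πi m·D(x)}`
for `Φ = id + D` (`e_m = UnitAddTorus.mFourier m`, the character `x ↦ e^{2πi m·x}`); well defined
on `T³` because `m ∈ ℤ³` and `D` is periodic. [cite: BuckmasterEtAl2018, App. C Prop. C.2] -/
def phaseExp (m : Fin 3 → ℤ) (D : 𝕋³ → ℝ³) (x : 𝕋³) : ℂ :=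
  UnitAddTorus.mFourier m x * Complex.exp ((phaseArg m D x : ℂ) * Complex.I)

/-- The real form `cos(2π m·Φ(x) + θ) = Re(e^{iθ} e^{2πi m·Φ(x)})` of the phase factor, with a
constant phase shift `θ` (so that `θ = 0` is the cosine and `θ = -π/2` the sine of the phase; real
and imaginary parts of `c e^{ik·Φ}`, `c ∈ ℂ`, are of this form). [cite: BuckmasterEtAl2018, App. C Prop. C.2] -/
def phaseCos (m : Fin 3 → ℤ) (D : 𝕋³ → ℝ³) (θ : ℝ) (x : 𝕋³) : ℝ :=
  (Complex.exp ((θ : ℂ) * Complex.I) * phaseExp m D x).re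

/-- **Non-degeneracy of the phase** ("`Ĉ⁻¹ ≤ |∇Φ| ≤ Ĉ` on `T³`", Prop. C.2), for `Φ = id + D`:
the deformation `∇Φ(x) = Id + ∇D(x)` satisfies `Ĉ⁻¹|v| ≤ |(Id + ∇D(x))v| ≤ Ĉ|v|` for all
`x ∈ T³`, `v ∈ ℝ³` (`Torus.fderiv D x` the accepted derivative). [cite: BuckmasterEtAl2018, App. C Prop. C.2] -/
def IsNondegenerateDisplacement (Ĉ : ℝ) (D : 𝕋³ → ℝ³) : Prop :=
  ∀ (x : 𝕋³) (v : ℝ³), Ĉ⁻¹ * ‖v‖ ≤ ‖v + Torus.fderiv D x v‖ ∧ ‖v + Torus.fderiv D x v‖ ≤ Ĉ * ‖v‖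

/-- Powers `|m|^s ∈ [0, ∞]` of the Euclidean length `|m| = (∑ⱼ mⱼ²)^{1/2}` of a frequency vector
(`Torus.freqNormSq m = |m|²`), the "`|k|^{N}`, `|k|^{1-α}`, `|k|^{N-α}`" of Prop. C.2. [folklore] -/
def freqPow (m : Fin 3 → ℤ) (s : ℝ) : ℝ≥0∞ :=
  ENNReal.ofReal (Real.sqrt (freqNormSq m) ^ s)

variable {m : Fin 3 → ℤ} {D : 𝕋³ → ℝ³} {θ : ℝ} {x : 𝕋³}

/-- `|e^{2πi m·Φ(x)}| = 1`. [folklore] -/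
theorem norm_phaseExp (m : Fin 3 → ℤ) (D : 𝕋³ → ℝ³) (x : 𝕋³) : ‖phaseExp m D x‖ = 1 := by
  have h1 : ‖UnitAddTorus.mFourier m x‖ = 1 := by
    simp [UnitAddTorus.mFourier]
  rw [phaseExp, norm_mul, h1, Complex.norm_exp_ofReal_mul_I, mul_one]

/-- `|cos(2π m·Φ(x) + θ)| ≤ 1`. [folklore] -/
theorem abs_phaseCos_le_one (m : Fin 3 → ℤ) (D : 𝕋³ → ℝ³) (θ : ℝ) (x : 𝕋³) :
    |phaseCos m D θ x| ≤ 1 := by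
  refine (Complex.abs_re_le_norm _).trans ?_
  rw [norm_mul, Complex.norm_exp_ofReal_mul_I, norm_phaseExp, one_mul]

/-- Without displacement the phase factor is the character `e_m`. [folklore] -/
theorem phaseExp_zero_disp (m : Fin 3 → ℤ) (x : 𝕋³) :
    phaseExp m (fun _ => 0) x = UnitAddTorus.mFourier m x := by
  simp [phaseExp, phaseArg]

/-- The identity displacement-free phase is non-degenerate with `Ĉ = 1`. [folklore] -/
theorem isNondegenerateDisplacement_zero : IsNondegenerateDisplacement 1 (fun _ : 𝕋³ => (0 : ℝ³)) := by
  intro x v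
  have h : Torus.fderiv (fun _ : 𝕋³ => (0 : ℝ³)) x = 0 := by
    unfold Torus.fderiv liftAt
    exact fderiv_const_apply _
  simp [h]

/-- The periodic part of the phase is smooth for a smooth displacement. [folklore] -/
theorem isSmooth_phaseArg (m : Fin 3 → ℤ) (hD : IsSmooth D) : IsSmooth (phaseArg m D) := by
  unfold phaseArg IsSmooth lift
  simp only [Function.comp_def]
  refine contDiff_const.mul (ContDiff.sum fun j _ => contDiff_const.mul ?_)
  exact hD.apply j

/-- The phase factor is smooth for a smooth displacement. [folklore] -/
theorem isSmooth_phaseExp (m : Fin 3 → ℤ) (hD : IsSmooth D) : IsSmooth (phaseExp m D) := by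
  have h1 : IsSmooth (⇑(UnitAddTorus.mFourier m) : 𝕋³ → ℂ) := isSmooth_mFourier m
  have h2 : IsSmooth fun x => Complex.exp ((phaseArg m D x : ℂ) * Complex.I) := by
    unfold IsSmooth lift
    simp only [Function.comp_def]
    refine ContDiff.cexp (ContDiff.mul ?_ contDiff_const)
    exact Complex.ofRealCLM.contDiff.comp (isSmooth_phaseArg m hD)
  exact h1.mul h2

/-- The real phase factor is smooth for a smooth displacement. [folklore] -/
theorem isSmooth_phaseCos (m : Fin 3 → ℤ) (hD : IsSmooth D) (θ : ℝ) : IsSmooth (phaseCos m D θ) := by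
  have h : IsSmooth fun x => Complex.exp ((θ : ℂ) * Complex.I) * phaseExp m D x :=
    (isSmooth_const _).mul (isSmooth_phaseExp m hD)
  exact IsSmooth.comp_clm (Complex.reCLM.restrictScalars ℝ) h

/-- `|m| ≥ 1` for `m ≠ 0`. [folklore] -/
theorem one_le_sqrt_freqNormSq (hm : m ≠ 0) : 1 ≤ Real.sqrt (freqNormSq m) := by
  rw [show (1 : ℝ) = Real.sqrt 1 by simp]
  exact Real.sqrt_le_sqrt (one_le_freqNormSq_of_ne_zero hm)

/-- `|m|^{-s} ≤ 1` for `m ≠ 0` and `s ≥ 0`. [folklore] -/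
theorem freqPow_neg_le_one (hm : m ≠ 0) {s : ℝ} (hs : 0 ≤ s) : freqPow m (-s) ≤ 1 := by
  unfold freqPow
  rw [← ENNReal.ofReal_one]
  exact ENNReal.ofReal_le_ofReal
    (Real.rpow_le_one_of_one_le_of_nonpos (one_le_sqrt_freqNormSq hm) (by linarith))

/-- `|m|^{s} · |m|^{t} = |m|^{s+t}` for `m ≠ 0`. [folklore] -/
theorem freqPow_mul (hm : m ≠ 0) (s t : ℝ) : freqPow m s * freqPow m t = freqPow m (s + t) := by
  have h0 : 0 < Real.sqrt (freqNormSq m) := lt_of_lt_of_le one_pos (one_le_sqrt_freqNormSq hm)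
  unfold freqPow
  rw [← ENNReal.ofReal_mul (Real.rpow_nonneg h0.le _), ← Real.rpow_add h0]

end Phase

/-! ## Prop. C.2 as named facts -/

section Facts

/-- **Stationary phase, (C.1)** (BDSV App. C, Prop. C.2, first part: for `N ≥ 1`, `a ∈ C^∞(T³)`
and a phase with `Ĉ⁻¹ ≤ |∇Φ| ≤ Ĉ`, `|∫_{T³} a(x) e^{ik·Φ} dx| ≲ (‖a‖_N + ‖a‖₀‖Φ‖_N)/|k|^N`, the
implicit constant depending on `Ĉ` and `N` but not on `k`; Daneri–Székelyhidi 2017,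
Lemma 2.2 (i): `|∫ a e^{iλφ}| ≤ C([a]_N + ‖a‖₀[∇φ]_N)/λ^N`). Transcription (module docstring):
phase `e^{2πi m·Φ}`, `Φ = id + D`, in the real form `BDSV.phaseCos m D θ` (any constant shift
`θ`); non-degeneracy `BDSV.IsNondegenerateDisplacement Ĉ D`; for every `Ĉ ≥ 1` and `N ≥ 1` a
constant `C`, then for all smooth non-degenerate `D`, all `m ≠ 0`, `θ`, and smooth real `a`:
`|∫ a(x) cos(2π m·Φ(x) + θ) dx| ≤ C |m|^{-N} (‖a‖_{C^N} + ‖a‖_{C^0} ‖D‖_{C^{N+1}})`, norms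
`Torus.eContDiffHolderNorm · 0`. [cite: BuckmasterEtAl2018, App. C Prop. C.2 (C.1)] -/
def phaseIntegralBound : Prop :=
  ∀ Ĉ : ℝ, 1 ≤ Ĉ → ∀ N : ℕ, 1 ≤ N → ∃ C : ℝ≥0,
    ∀ D : 𝕋³ → ℝ³, IsSmooth D → IsNondegenerateDisplacement Ĉ D →
      ∀ m : Fin 3 → ℤ, m ≠ 0 → ∀ (θ : ℝ) (a : 𝕋³ → ℝ), IsSmooth a →
        ‖∫ x, phaseCos m D θ x * a x‖ₑ ≤
          C * freqPow m (-(N : ℝ)) *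
            (Torus.eContDiffHolderNorm N 0 a +
              Torus.eContDiffHolderNorm 0 0 a * Torus.eContDiffHolderNorm (N + 1) 0 D)

/-- **Stationary phase for the antidivergence `ℛ`** (BDSV App. C, Prop. C.2, second part: for
`α ∈ (0,1)`, `N ≥ 1`, `a ∈ C^∞(T³)` and a phase with `Ĉ⁻¹ ≤ |∇Φ| ≤ Ĉ`,
`‖ℛ(a e^{ik·Φ})‖_α ≲ ‖a‖₀/|k|^{1-α} + (‖a‖_{N+α} + ‖a‖₀‖Φ‖_{N+α})/|k|^{N-α}`, "where the implicit
constant depends on `Ĉ`, `α` and `N`, but not on `k`"; Daneri–Székelyhidi 2017, Lemma 2.2 (ii)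
and its corollary for `ℛ`). Transcription (module docstring): `ℛ = Torus.antidivergence` (the
accepted De Lellis–Székelyhidi operator, BDSV (4.1)) applied to the real vector field
`x ↦ cos(2π m·Φ(x) + θ) a(x)`, `a : T³ → ℝ³` smooth; for every `Ĉ ≥ 1`, `0 < α < 1`, `N ≥ 1` a
constant `C`, then for all smooth non-degenerate `D`, `m ≠ 0`, `θ`, smooth `a`:
`‖ℛ(cos(2π m·Φ + θ) a)‖_{C^{0,α}} ≤ C (|m|^{-(1-α)} ‖a‖_{C^0} + |m|^{-(N-α)} (‖a‖_{C^{N,α}} + ‖a‖_{C^0} ‖D‖_{C^{N+1,α}}))`.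
[cite: BuckmasterEtAl2018, App. C Prop. C.2] -/
def antidivergencePhaseBound : Prop :=
  ∀ Ĉ : ℝ, 1 ≤ Ĉ → ∀ α : ℝ≥0, 0 < α → α < 1 → ∀ N : ℕ, 1 ≤ N → ∃ C : ℝ≥0,
    ∀ D : 𝕋³ → ℝ³, IsSmooth D → IsNondegenerateDisplacement Ĉ D →
      ∀ m : Fin 3 → ℤ, m ≠ 0 → ∀ (θ : ℝ) (a : 𝕋³ → ℝ³), IsSmooth a →
        Torus.eContDiffHolderNorm 0 α (Torus.antidivergence fun x => phaseCos m D θ x • a x) ≤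
          C * (freqPow m (-(1 - (α : ℝ))) * Torus.eContDiffHolderNorm 0 0 a +
            freqPow m (-((N : ℝ) - α)) *
              (Torus.eContDiffHolderNorm N α a +
                Torus.eContDiffHolderNorm 0 0 a * Torus.eContDiffHolderNorm (N + 1) α D))

end Facts

end BDSV

end Literature.Analysis.FluidPDE
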